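import Mathlib
import HarnessLib
import Summits.HubbardSuperconductivity.HubbardSuperconductivity.Theorems.KLProgrammeKLRegimeEngineFrameShiftDressingSupFlow

/-!
# K3 gen-8-FLOW (stmt 20437 `KLRegimeEngineV17F2`, stub (C), located risk «(C)-B-REP»/«(C)-B-ALIAS-L»): the corrected (B) door at the flow frames with
# the tree and dressing jets discharged FROM THE FLOW TABLES — every constant explicit

Cell gate-hubbard-kl, seat p2 g14.  `…EngineFrameShiftDressingSupFlow.norm_iteratedFDeriv_klLocSelfEnergyRe_flowFrame_sub_le_aliasing` (p581176) left six
sup-table numbers `D_d, A_d, D_a, A_a, D_b, A_b` of the dressing symbols as inputs; `…EngineFrameShiftDressingFactorTables` (p576420) supplies them from the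
flow's band/mismatch envelopes (`E_u(m) = 4 + 4^m·2^{10}(1+S₀)`, `F_v = 2^{10}4^m`, `S₀16^{−m} ≤ δ ≤ Λ_m/4`, cutoff table `‖χ₂^{(l)}‖ ≤ X`, `l ≤ Md`).  Here the two are
composed: **`norm_iteratedFDeriv_klLocSelfEnergyRe_flowFrame_sub_le_aliasing_tables`** — the (B) door whose only inputs beyond the door's own (FrameOK of both
frames, `fd ≤ Λ_m/4`, `Z`, the tower input `N`) are the flow history (`FlowPieceJetsAt`, `TwoLegReadJetsF`), the reading point below both shells, `δ`, `X`, and the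
two-leg `(1+|x̃|)`-moments `S_j, S_s, S_j′, S_s′`; the constants `A = A′`, `A_J` are closed terms — polynomial in `L` times `(2/N)^{Md−j−4}` resp. `(1+L/4)^{−s}`
(located risk «(C)-B-ALIAS-L»: memo ALIAS-L-NUMBERS-p2g14.md prices the volume threshold).  Proofs only; no definitions; nothing asserts superconductivity.
References: BGM 2006 §2.3 (2.21)–(2.24), §3 (3.2)–(3.3) [cite: BenfattoGiulianiMastropietro2006]; FST 1996 §1.
-/

noncomputable section

namespace Summit.HubbardSuperconductivity.HubbardSuperconductivity.Theorems.EngineV8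

set_option linter.dupNamespace false -- summit = problem name (single-conjunct summit), D-0017

open Real Finset Filter Literature.MathematicalPhysics.QuantumLattice Literature.Probability.LatticeModels GrassmannAlgebra
open Summit.HubbardSuperconductivity.HubbardSuperconductivity.Theorems.KLRegimeSplit
open Summit.HubbardSuperconductivity.HubbardSuperconductivity.Theorems.TwoVolumeDefect
open Summit.HubbardSuperconductivity.HubbardSuperconductivity.Theorems.KLProgrammeLegKernels
open Summit.HubbardSuperconductivity.HubbardSuperconductivity.Theorems.DispersionFlow

variable {L M : ℕ} [NeZero L] [NeZero M]

section Flow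

variable {β : ℝ} (hβ : 0 < β) (U μ : ℝ) (m : ℕ)
include hβ

/-- **THE CORRECTED (B) DOOR AT THE FLOW FRAMES, TREE AND DRESSING JETS DISCHARGED FROM THE FLOW TABLES**: `…_aliasing` (p581176) with the six sup-table
numbers SUPPLIED by `…EngineFrameShiftDressingFactorTables` (p576420) — every constant explicit in `(G, Q, R, X, U, β, L, m, δ, Md, j, s)`; remaining inputs: the
door's own, the reading point below both shells, the flow history (`FlowPieceJetsAt`, `TwoLegReadJetsF` up to `n ≥ m`), the cutoff table up to order `Md`, the
mismatch envelope `S₀16^{−m} ≤ δ ≤ Λ_m/4`, and the two-leg moments `S_j, S_s, S_j′, S_s′`. [cite: BenfattoGiulianiMastropietro2006, §2.3 (2.21)–(2.24)] -/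
theorem norm_iteratedFDeriv_klLocSelfEnergyRe_flowFrame_sub_le_aliasing_tables
    {G : GeoConsts} {Q : EngConsts} {R : RenConsts} (hRG : ∀ j, 0 ≤ R.Gfr j) (hGS : ∀ k, 0 ≤ G.S k) (hQS : ∀ k, 0 ≤ Q.S' k) (hμ : μ ∈ klWindowC)
    {Nf₁ Nf₂ : ℕ} (hOK₁ : FrameOK R U Nf₁ μ (klFlowFrameU L M β U μ m)) (hOK₂ : FrameOK R U Nf₂ μ (klFlowFrameU L M β U μ (m + 1)))
    {B₁ : ℝ} (hB0 : 0 ≤ B₁) (hB : ∀ y, |deriv salmhoferCutoff y| ≤ B₁)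
    {fd : ℝ} (hfdist : frameDist (klFlowFrameU L M β U μ (m + 1)) (klFlowFrameU L M β U μ m) ≤ fd) (hfd : fd ≤ (klScale klE0 m) / 4)
    (hZ₂ : IsUnit (effPartitionFn ℂ (normalCovariance L M (uvSymbolCT L M β μ (klFlowFrameU L M β U μ (m + 1)) (klScale klE0 m))) (hubbardInteraction L M β U + counterQuadratic L M β (klFlowFrameU L M β U μ (m + 1)))))
    (hZ : ∀ t ∈ Set.Icc (0 : ℝ) 1, effPartitionFn ℂ
      (normalCovariance L M (uvSymbolCT L M β μ (klFlowFrameU L M β U μ m) (klScale klE0 m)) + ((t : ℂ)) • (normalCovariance L M (fun ks => uvSymbolCT L M β μ (klFlowFrameU L M β U μ (m + 1)) (klScale klE0 m) ks / (1 + uvSymbolCT L M β μ (klFlowFrameU L M β U μ (m + 1)) (klScale klE0 m) ks * (((fsub (klFlowFrameU L M β U μ (m + 1)) (klFlowFrameU L M β U μ m)).eval (latticeMomentum L ks.1.2) / (β * (L : ℝ) ^ 2) : ℝ) : ℂ))) - normalCovariance L M (uvSymbolCT L M β μ (klFlowFrameU L M β U μ m) (klScale klE0 m)))) (hubbardInteraction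 L M β U + counterQuadratic L M β (klFlowFrameU L M β U μ m)) ≠ 0)
    (j : ℕ) (q : Momentum) {N : ℝ} (hN0 : 0 ≤ N)
    (hN : ∀ t ∈ Set.Icc (0 : ℝ) 1, ∀ i ∈ ({omega0 M, (omega0 M).rev} : Finset (MatsubaraIdx M)), ∀ σ : Fin 2, ∀ Al : HubbardFieldIdx L M,
      |matsubaraFreq β M Al.1.1.1| < (klScale klE0 m) →
      (|nambuXiCT L μ (klFlowFrameU L M β U μ m) Al.1.1.2| < (klScale klE0 m) ∨ |nambuXiCT L μ (klFlowFrameU L M β U μ (m + 1)) Al.1.1.2| < (klScale klE0 m)) →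
      ∑ x : TorusSite 2 L, (1 + ((x 0).valMinAbs.natAbs : ℝ) + ((x 1).valMinAbs.natAbs : ℝ)) ^ j * ‖torusFourierInv (fun kv : TorusSite 2 L =>
        kernel ℂ (effAction ℂ (normalCovariance L M (uvSymbolCT L M β μ (klFlowFrameU L M β U μ m) (klScale klE0 m)) + ((t : ℂ)) • (normalCovariance L M (fun ks => uvSymbolCT L M β μ (klFlowFrameU L M β U μ (m + 1)) (klScale klE0 m) ks / (1 + uvSymbolCT L M β μ (klFlowFrameU L M β U μ (m + 1)) (klScale klE0 m) ks * (((fsub (klFlowFrameU L M β U μ (m + 1)) (klFlowFrameU L M β U μ m)).eval (latticeMomentum L ks.1.2) / (β * (L : ℝ) ^ 2) : ℝ) : ℂ))) - normalCovariance L M (uvSymbolCT L M β μ (klFlowFrameU L M β U μ m) (klScale klE0 m)))) (hubbardInteraction L M β U + counterQuadratic L M β (klFlowFrameU L M β U μ m))) 4 (Fin.snoc (Fin.snoc ![((((i, kv), σ), 0) : HubbardFieldIdx L M), (((i, kv), σ), 1)] (Al.1, 1 - Al.2) : Fin 3 → HubbardFieldIdx L M) Al)) x‖ ≤ N)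
    (hq₂ : (Real.pi / β) ^ 2 + frameLevel μ (klFlowFrameU L M β U μ (m + 1)) q ^ 2 < (klScale klE0 m) ^ 2 / 4) (hq₁ : (Real.pi / β) ^ 2 + frameLevel μ (klFlowFrameU L M β U μ m) q ^ 2 < (klScale klE0 m) ^ 2 / 4)
    {Md s : ℕ} (hM : 4 + j ≤ Md) {Sj Ss Sj' Ss' : ℝ}
    (hRmom : ∀ t ∈ Set.Icc (0 : ℝ) 1, ∀ i ∈ ({omega0 M, (omega0 M).rev} : Finset (MatsubaraIdx M)), ∀ σ : Fin 2,
      (∑ x : TorusSite 2 L, (1 + ((x 0).valMinAbs.natAbs : ℝ) + ((x 1).valMinAbs.natAbs : ℝ)) ^ j * ‖torusFourierInv (fun kv : TorusSite 2 L =>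
        kernel ℂ (effAction ℂ (normalCovariance L M (uvSymbolCT L M β μ (klFlowFrameU L M β U μ m) (klScale klE0 m)) + ((t : ℂ)) • (normalCovariance L M (fun ks => uvSymbolCT L M β μ (klFlowFrameU L M β U μ (m + 1)) (klScale klE0 m) ks / (1 + uvSymbolCT L M β μ (klFlowFrameU L M β U μ (m + 1)) (klScale klE0 m) ks * (((fsub (klFlowFrameU L M β U μ (m + 1)) (klFlowFrameU L M β U μ m)).eval (latticeMomentum L ks.1.2) / (β * (L : ℝ) ^ 2) : ℝ) : ℂ))) - normalCovariance L M (uvSymbolCT L M β μ (klFlowFrameU L M β U μ m) (klScale klE0 m)))) (hubbardInteraction L M β U + counterQuadratic L M β (klFlowFrameU L M β U μ m))) 2 ![((((i, kv), σ), 0) : HubbardFieldIdx L M), (((i, kv), σ), 1)]) x‖ ≤ Sj) ∧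
      (∑ x : TorusSite 2 L, (1 + ((x 0).valMinAbs.natAbs : ℝ) + ((x 1).valMinAbs.natAbs : ℝ)) ^ s * ‖torusFourierInv (fun kv : TorusSite 2 L =>
        kernel ℂ (effAction ℂ (normalCovariance L M (uvSymbolCT L M β μ (klFlowFrameU L M β U μ m) (klScale klE0 m)) + ((t : ℂ)) • (normalCovariance L M (fun ks => uvSymbolCT L M β μ (klFlowFrameU L M β U μ (m + 1)) (klScale klE0 m) ks / (1 + uvSymbolCT L M β μ (klFlowFrameU L M β U μ (m + 1)) (klScale klE0 m) ks * (((fsub (klFlowFrameU L M β U μ (m + 1)) (klFlowFrameU L M β U μ m)).eval (latticeMomentum L ks.1.2) / (β * (L : ℝ) ^ 2) : ℝ) : ℂ))) - normalCovariance L M (uvSymbolCT L M β μ (klFlowFrameU L M β U μ m) (klScale klE0 m)))) (hubbardInteraction L M β U + counterQuadratic L M β (klFlowFrameU L M β U μ m))) 2 ![((((i, kv), σ), 0) : HubbardFieldIdx L M), (((i, kv), σ), 1)]) x‖ ≤ Ss))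
    (hSE : ∀ i ∈ ({omega0 M, (omega0 M).rev} : Finset (MatsubaraIdx M)), ∀ σ : Fin 2,
      (∑ x : TorusSite 2 L, (1 + ((x 0).valMinAbs.natAbs : ℝ) + ((x 1).valMinAbs.natAbs : ℝ)) ^ j * ‖torusFourierInv (fun kv : TorusSite 2 L =>
        selfEnergy L M β (effAction ℂ (normalCovariance L M (fun ks => uvSymbolCT L M β μ (klFlowFrameU L M β U μ (m + 1)) (klScale klE0 m) ks / (1 + uvSymbolCT L M β μ (klFlowFrameU L M β U μ (m + 1)) (klScale klE0 m) ks * (((fsub (klFlowFrameU L M β U μ (m + 1)) (klFlowFrameU L M β U μ m)).eval (latticeMomentum L ks.1.2) / (β * (L : ℝ) ^ 2) : ℝ) : ℂ)))) (hubbardInteraction L M β U + counterQuadratic L M β (klFlowFrameU L M β U μ m))) (i, kv) σ) x‖ ≤ Sj') ∧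
      (∑ x : TorusSite 2 L, (1 + ((x 0).valMinAbs.natAbs : ℝ) + ((x 1).valMinAbs.natAbs : ℝ)) ^ s * ‖torusFourierInv (fun kv : TorusSite 2 L =>
        selfEnergy L M β (effAction ℂ (normalCovariance L M (fun ks => uvSymbolCT L M β μ (klFlowFrameU L M β U μ (m + 1)) (klScale klE0 m) ks / (1 + uvSymbolCT L M β μ (klFlowFrameU L M β U μ (m + 1)) (klScale klE0 m) ks * (((fsub (klFlowFrameU L M β U μ (m + 1)) (klFlowFrameU L M β U μ m)).eval (latticeMomentum L ks.1.2) / (β * (L : ℝ) ^ 2) : ℝ) : ℂ)))) (hubbardInteraction L M β U + counterQuadratic L M β (klFlowFrameU L M β U μ m))) (i, kv) σ) x‖ ≤ Ss'))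
    -- the flow tables (`…EngineFrameShiftDressingFactorTables`)
    {X : ℝ} (hX1 : 1 ≤ X) (hX : ∀ l ≤ Md, ∀ x : ℝ, ‖iteratedFDeriv ℝ l salmhoferCutoff x‖ ≤ X)
    {n : ℕ} (hP : ∀ m' ≤ n, FlowPieceJetsAt L M β U μ R m') (hTJ : ∀ m' ≤ n, TwoLegReadJetsF L M G Q β U μ m') (hmn : m ≤ n)
    {δ : ℝ} (hδ : (Real.pi ^ 8 * ((curveExtC X G.S 1 + curveExtC X Q.S' 1 * |U|) * U ^ 2) + ∑ j ∈ range 5, R.Gfr j * uPow j U) * ((16 : ℝ) ^ m)⁻¹ ≤ δ)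
    (hδΛ : δ ≤ (klScale klE0 m) / 4) :
    ‖iteratedFDeriv ℝ j (evalM (symInterp L (fun kv : TorusSite 2 L =>
        klLocSelfEnergyRe L M β U μ (klFlowFrameU L M β U μ (m + 1)) m kv - klLocSelfEnergyRe L M β U μ (klFlowFrameU L M β U μ m) m kv - (fsub (klFlowFrameU L M β U μ (m + 1)) (klFlowFrameU L M β U μ m)).eval (latticeMomentum L kv)))) q‖ ≤
      2 * (2 * (|β| * (L : ℝ) ^ 2) * (12 * (2 * ((klScale klE0 m) * β / Real.pi + 3) *
        ((1793 * (klScale klE0 m) * (L : ℝ) ^ 2 + 704 * L) + (1793 * (klScale klE0 m) * (L : ℝ) ^ 2 + 704 * L)) *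
        (β * (L : ℝ) ^ 2 * (200 + 200 * B₁) / (klScale klE0 m) ^ 2 * fd)) * N)) +
      (4 * (2 * (2 * ((2 * |β| * (L : ℝ) ^ 2 * Sj ^ 2) * ((3 : ℝ) ^ j * (X * (|(β * (L : ℝ) ^ 2)| * (6 / klScale klE0 m)) * (Nat.factorial Md : ℝ) *
          (2 * (8 * (4 * (4 + (4 : ℝ) ^ m * (2 ^ 10 *
              (1 + (Real.pi ^ 8 * ((curveExtC X G.S 1 + curveExtC X Q.S' 1 * |U|) * U ^ 2) + ∑ j ∈ range 5, R.Gfr j * uPow j U)))) *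
              (1 + 4 / klScale klE0 m * 1) + 2 ^ 10 * (4 : ℝ) ^ m) * (1 + 6 / klScale klE0 m * (1 + δ * X)))) ^ Md +
        |(β * (L : ℝ) ^ 2)| * X * (4 / klScale klE0 m) * (Nat.factorial Md : ℝ) *
          (4 * ((4 + (4 : ℝ) ^ m * (2 ^ 10 *
              (1 + (Real.pi ^ 8 * ((curveExtC X G.S 1 + curveExtC X Q.S' 1 * |U|) * U ^ 2) + ∑ j ∈ range 5, R.Gfr j * uPow j U)))) +
            2 ^ 10 * (4 : ℝ) ^ m) * (1 + 4 / klScale klE0 m * (1 + δ))) ^ Md) * (2 / ((2 * (L / 4 + 1) : ℕ) : ℝ)) ^ (Md - j - 4) * (2 ^ 2 * ∑' k : Fin 2 → ℤ, ∏ c, (1 + (k c : ℝ) ^ 2)⁻¹)))) + (L : ℝ) ^ 2 * (L : ℝ) ^ j * ((X * (|(β * (L : ℝ) ^ 2)| * (6 / klScale klE0 m)) * (Nat.factorial 0 : ℝ) *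
          (2 * (8 * (4 * (4 + (4 : ℝ) ^ m * (2 ^ 10 *
              (1 + (Real.pi ^ 8 * ((curveExtC X G.S 1 + curveExtC X Q.S' 1 * |U|) * U ^ 2) + ∑ j ∈ range 5, R.Gfr j * uPow j U)))) *
              (1 + 4 / klScale klE0 m * 1) + 2 ^ 10 * (4 : ℝ) ^ m) * (1 + 6 / klScale klE0 m * (1 + δ * X)))) ^ 0 +
        |(β * (L : ℝ) ^ 2)| * X * (4 / klScale klE0 m) * (Nat.factorial 0 : ℝ) *
          (4 * ((4 + (4 : ℝ) ^ m * (2 ^ 10 *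
              (1 + (Real.pi ^ 8 * ((curveExtC X G.S 1 + curveExtC X Q.S' 1 * |U|) * U ^ 2) + ∑ j ∈ range 5, R.Gfr j * uPow j U)))) +
            2 ^ 10 * (4 : ℝ) ^ m) * (1 + 4 / klScale klE0 m * (1 + δ))) ^ 0) * ((2 * |β| * (L : ℝ) ^ 2 * Ss ^ 2) / (1 + (L : ℝ) / 4) ^ s)))) + (2 * (2 : ℕ) * ((2 * (2 * ((1 / 4 : ℝ) * ((3 : ℝ) ^ j * ((δ * δ / |(β * (L : ℝ) ^ 2)|) * (X * (|(β * (L : ℝ) ^ 2)| * (6 / klScale klE0 m))) * (Nat.factorial Md : ℝ) *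
        (2 * (2 * (2 ^ 10 * (4 : ℝ) ^ m) + 2 * (8 * (4 * (4 + (4 : ℝ) ^ m * (2 ^ 10 *
            (1 + (Real.pi ^ 8 * ((curveExtC X G.S 1 + curveExtC X Q.S' 1 * |U|) * U ^ 2) + ∑ j ∈ range 5, R.Gfr j * uPow j U)))) *
            (1 + 4 / klScale klE0 m * 1) + 2 ^ 10 * (4 : ℝ) ^ m) * (1 + 6 / klScale klE0 m * (1 + δ * X))))) ^ Md) * (2 / ((2 * (L / 4 + 1) : ℕ) : ℝ)) ^ (Md - j - 4) * (2 ^ 2 * ∑' k : Fin 2 → ℤ, ∏ c, (1 + (k c : ℝ) ^ 2)⁻¹)))) + (L : ℝ) ^ 2 * (L : ℝ) ^ j * (((δ * δ / |(β * (L : ℝ) ^ 2)|) * (X * (|(β * (L : ℝ) ^ 2)| * (6 / klScale klE0 m))) * (Nat.factorial 0 : ℝ) *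
        (2 * (2 * (2 ^ 10 * (4 : ℝ) ^ m) + 2 * (8 * (4 * (4 + (4 : ℝ) ^ m * (2 ^ 10 *
            (1 + (Real.pi ^ 8 * ((curveExtC X G.S 1 + curveExtC X Q.S' 1 * |U|) * U ^ 2) + ∑ j ∈ range 5, R.Gfr j * uPow j U)))) *
            (1 + 4 / klScale klE0 m * 1) + 2 ^ 10 * (4 : ℝ) ^ m) * (1 + 6 / klScale klE0 m * (1 + δ * X))))) ^ 0) * ((1 / 4 : ℝ) / (1 + (L : ℝ) / 4) ^ s))) + (2 * (2 * ((1 / 4 * Sj') * ((3 : ℝ) ^ j * ((δ / |(β * (L : ℝ) ^ 2)| * (X * (|(β * (L : ℝ) ^ 2)| * (6 / klScale klE0 m)))) * (δ / |(β * (L : ℝ) ^ 2)| * (X * (|(β * (L : ℝ) ^ 2)| * (6 / klScale klE0 m)))) * (Nat.factorial Md : ℝ) *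
          (2 * (2 * (2 * (2 ^ 10 * (4 : ℝ) ^ m) + 2 * (8 * (4 * (4 + (4 : ℝ) ^ m * (2 ^ 10 *
              (1 + (Real.pi ^ 8 * ((curveExtC X G.S 1 + curveExtC X Q.S' 1 * |U|) * U ^ 2) + ∑ j ∈ range 5, R.Gfr j * uPow j U)))) *
              (1 + 4 / klScale klE0 m * 1) + 2 ^ 10 * (4 : ℝ) ^ m) * (1 + 6 / klScale klE0 m * (1 + δ * X)))))) ^ Md +
        2 * ((δ / |(β * (L : ℝ) ^ 2)|) * (X * (|(β * (L : ℝ) ^ 2)| * (6 / klScale klE0 m))) * (Nat.factorial Md : ℝ) *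
          (2 * (2 * (2 ^ 10 * (4 : ℝ) ^ m) + 2 * (8 * (4 * (4 + (4 : ℝ) ^ m * (2 ^ 10 *
              (1 + (Real.pi ^ 8 * ((curveExtC X G.S 1 + curveExtC X Q.S' 1 * |U|) * U ^ 2) + ∑ j ∈ range 5, R.Gfr j * uPow j U)))) *
              (1 + 4 / klScale klE0 m * 1) + 2 ^ 10 * (4 : ℝ) ^ m) * (1 + 6 / klScale klE0 m * (1 + δ * X))))) ^ Md)) * (2 / ((2 * (L / 4 + 1) : ℕ) : ℝ)) ^ (Md - j - 4) * (2 ^ 2 * ∑' k : Fin 2 → ℤ, ∏ c, (1 + (k c : ℝ) ^ 2)⁻¹)))) + (L : ℝ) ^ 2 * (L : ℝ) ^ j * (((δ / |(β * (L : ℝ) ^ 2)| * (X * (|(β * (L : ℝ) ^ 2)| * (6 / klScale klE0 m)))) * (δ / |(β * (L : ℝ) ^ 2)| * (X * (|(β * (L : ℝ) ^ 2)| * (6 / klScale klE0 m)))) * (Nat.factorial 0 : ℝ) *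
          (2 * (2 * (2 * (2 ^ 10 * (4 : ℝ) ^ m) + 2 * (8 * (4 * (4 + (4 : ℝ) ^ m * (2 ^ 10 *
              (1 + (Real.pi ^ 8 * ((curveExtC X G.S 1 + curveExtC X Q.S' 1 * |U|) * U ^ 2) + ∑ j ∈ range 5, R.Gfr j * uPow j U)))) *
              (1 + 4 / klScale klE0 m * 1) + 2 ^ 10 * (4 : ℝ) ^ m) * (1 + 6 / klScale klE0 m * (1 + δ * X)))))) ^ 0 +
        2 * ((δ / |(β * (L : ℝ) ^ 2)|) * (X * (|(β * (L : ℝ) ^ 2)| * (6 / klScale klE0 m))) * (Nat.factorial 0 : ℝ) *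
          (2 * (2 * (2 ^ 10 * (4 : ℝ) ^ m) + 2 * (8 * (4 * (4 + (4 : ℝ) ^ m * (2 ^ 10 *
              (1 + (Real.pi ^ 8 * ((curveExtC X G.S 1 + curveExtC X Q.S' 1 * |U|) * U ^ 2) + ∑ j ∈ range 5, R.Gfr j * uPow j U)))) *
              (1 + 4 / klScale klE0 m * 1) + 2 ^ 10 * (4 : ℝ) ^ m) * (1 + 6 / klScale klE0 m * (1 + δ * X))))) ^ 0)) * ((1 / 4 * Ss') / (1 + (L : ℝ) / 4) ^ s))))) := by
  have h4N : 4 ≤ Md := by omega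
  have hω : ∀ i : MatsubaraIdx M, matsubaraFreq β M i ≠ 0 := fun i => matsubaraFreq_ne_zero hβ.ne' i
  have h1 : ∀ i ∈ ({omega0 M, (omega0 M).rev} : Finset (MatsubaraIdx M)), ∀ q' : Momentum, ‖iteratedFDeriv ℝ Md (fun q : Momentum => ((((uvWeightFn (klScale klE0 m) (matsubaraFreq β M i) (frameLevel μ (klFlowFrameU L M β U μ (m + 1)) q) : ℝ) : ℂ) * resolventFnXi (β * (L : ℝ) ^ 2) 0 (matsubaraFreq β M i) (frameLevel μ (klFlowFrameU L M β U μ (m + 1)) q + uvWeightFn (klScale klE0 m) (matsubaraFreq β M i) (frameLevel μ (klFlowFrameU L M β U μ (m + 1)) q) * evalM (fsub (klFlowFrameU L M β U μ (m + 1)) (klFlowFrameU L M β U μ m)) q)) - uvSymbolFnXi (β * (L : ℝ) ^ 2) (klScale klE0 m) (matsubaraFreq β M i) (frameLevel μ (klFlowFrameU L M β U μ (m + 1)) q + evalM (fsub (klFlowFrameU L M β U μ (m + 1)) (klFlowFrameU L M β U μ m)) q))) q'‖ ≤ X * (|(β * (L : ℝ) ^ 2)| * (6 / klScale klE0 m))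 * (Nat.factorial Md : ℝ) *
          (2 * (8 * (4 * (4 + (4 : ℝ) ^ m * (2 ^ 10 *
              (1 + (Real.pi ^ 8 * ((curveExtC X G.S 1 + curveExtC X Q.S' 1 * |U|) * U ^ 2) + ∑ j ∈ range 5, R.Gfr j * uPow j U)))) *
              (1 + 4 / klScale klE0 m * 1) + 2 ^ 10 * (4 : ℝ) ^ m) * (1 + 6 / klScale klE0 m * (1 + δ * X)))) ^ Md +
        |(β * (L : ℝ) ^ 2)| * X * (4 / klScale klE0 m) * (Nat.factorial Md : ℝ) *
          (4 * ((4 + (4 : ℝ) ^ m * (2 ^ 10 *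
              (1 + (Real.pi ^ 8 * ((curveExtC X G.S 1 + curveExtC X Q.S' 1 * |U|) * U ^ 2) + ∑ j ∈ range 5, R.Gfr j * uPow j U)))) +
            2 ^ 10 * (4 : ℝ) ^ m) * (1 + 4 / klScale klE0 m * (1 + δ))) ^ Md :=
    fun i _ q' => norm_iteratedFDeriv_defect_flowFrame_le (hR := hRG) (hGS := hGS) (hQS := hQS) (hμ := hμ) (h4N := h4N) (hX := hX) (hP := hP) (hT := hTJ)
      (hmn := hmn) (hδ := hδ) (hδΛ := hδΛ) (hω := hω i) (c := (β * (L : ℝ) ^ 2)) hX1 le_rfl q'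
  have h2 : ∀ i ∈ ({omega0 M, (omega0 M).rev} : Finset (MatsubaraIdx M)), ∀ q' : Momentum, ‖(fun q : Momentum => ((((uvWeightFn (klScale klE0 m) (matsubaraFreq β M i) (frameLevel μ (klFlowFrameU L M β U μ (m + 1)) q) : ℝ) : ℂ) * resolventFnXi (β * (L : ℝ) ^ 2) 0 (matsubaraFreq β M i) (frameLevel μ (klFlowFrameU L M β U μ (m + 1)) q + uvWeightFn (klScale klE0 m) (matsubaraFreq β M i) (frameLevel μ (klFlowFrameU L M β U μ (m + 1)) q) * evalM (fsub (klFlowFrameU L M β U μ (m + 1)) (klFlowFrameU L M β U μ m)) q)) - uvSymbolFnXi (β * (L : ℝ) ^ 2) (klScale klE0 m) (matsubaraFreq β M i) (frameLevel μ (klFlowFrameU L M β U μ (m + 1)) q + evalM (fsub (klFlowFrameU L M β U μ (m + 1)) (klFlowFrameU L M β U μ m)) q))) q'‖ ≤ X * (|(β * (L : ℝ) ^ 2)| * (6 / klScale klE0 m)) * (Nat.factorial 0 : ℝ) *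
          (2 * (8 * (4 * (4 + (4 : ℝ) ^ m * (2 ^ 10 *
              (1 + (Real.pi ^ 8 * ((curveExtC X G.S 1 + curveExtC X Q.S' 1 * |U|) * U ^ 2) + ∑ j ∈ range 5, R.Gfr j * uPow j U)))) *
              (1 + 4 / klScale klE0 m * 1) + 2 ^ 10 * (4 : ℝ) ^ m) * (1 + 6 / klScale klE0 m * (1 + δ * X)))) ^ 0 +
        |(β * (L : ℝ) ^ 2)| * X * (4 / klScale klE0 m) * (Nat.factorial 0 : ℝ) *
          (4 * ((4 + (4 : ℝ) ^ m * (2 ^ 10 *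
              (1 + (Real.pi ^ 8 * ((curveExtC X G.S 1 + curveExtC X Q.S' 1 * |U|) * U ^ 2) + ∑ j ∈ range 5, R.Gfr j * uPow j U)))) +
            2 ^ 10 * (4 : ℝ) ^ m) * (1 + 4 / klScale klE0 m * (1 + δ))) ^ 0 := by
    intro i _ q'
    have h := norm_iteratedFDeriv_defect_flowFrame_le (hR := hRG) (hGS := hGS) (hQS := hQS) (hμ := hμ) (h4N := h4N) (hX := hX) (hP := hP) (hT := hTJ)
      (hmn := hmn) (hδ := hδ) (hδΛ := hδΛ) (hω := hω i) (c := (β * (L : ℝ) ^ 2)) hX1 (Nat.zero_le Md) q'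
    rw [norm_iteratedFDeriv_zero] at h
    exact h
  have h3 : ∀ i ∈ ({omega0 M, (omega0 M).rev} : Finset (MatsubaraIdx M)), ∀ q' : Momentum, ‖iteratedFDeriv ℝ Md (fun q : Momentum => (-((((evalM (fsub (klFlowFrameU L M β U μ (m + 1)) (klFlowFrameU L M β U μ m)) q * evalM (fsub (klFlowFrameU L M β U μ (m + 1)) (klFlowFrameU L M β U μ m)) q) / (β * (L : ℝ) ^ 2) : ℝ)) : ℂ) * (((uvWeightFn (klScale klE0 m) (matsubaraFreq β M i) (frameLevel μ (klFlowFrameU L M β U μ (m + 1)) q) : ℝ) : ℂ) * resolventFnXi (β * (L : ℝ) ^ 2) 0 (matsubaraFreq β M i) (frameLevel μ (klFlowFrameU L M β U μ (m + 1)) q + uvWeightFn (klScale klE0 m) (matsubaraFreq β M i) (frameLevel μ (klFlowFrameU L M β U μ (m + 1)) q) * evalM (fsub (klFlowFrameU L M β U μ (m + 1)) (klFlowFrameU L M β U μ m)) q)))) q'‖ ≤ (δ * δ / |(β * (L : ℝ) ^ 2)|) * (X * (|(β * (L : ℝ) ^ 2)| * (6 / klScale klE0 m))) * (Nat.factorial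 Md : ℝ) *
        (2 * (2 * (2 ^ 10 * (4 : ℝ) ^ m) + 2 * (8 * (4 * (4 + (4 : ℝ) ^ m * (2 ^ 10 *
            (1 + (Real.pi ^ 8 * ((curveExtC X G.S 1 + curveExtC X Q.S' 1 * |U|) * U ^ 2) + ∑ j ∈ range 5, R.Gfr j * uPow j U)))) *
            (1 + 4 / klScale klE0 m * 1) + 2 ^ 10 * (4 : ℝ) ^ m) * (1 + 6 / klScale klE0 m * (1 + δ * X))))) ^ Md :=
    fun i _ q' => norm_iteratedFDeriv_J₂_flowFrame_le (hR := hRG) (hGS := hGS) (hQS := hQS) (hμ := hμ) (h4N := h4N) (hX := hX) (hP := hP) (hT := hTJ)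
      (hmn := hmn) (hδ := hδ) (hδΛ := hδΛ) (hω := hω i) (c := (β * (L : ℝ) ^ 2)) le_rfl q'
  have h4 : ∀ i ∈ ({omega0 M, (omega0 M).rev} : Finset (MatsubaraIdx M)), ∀ q' : Momentum, ‖(fun q : Momentum => (-((((evalM (fsub (klFlowFrameU L M β U μ (m + 1)) (klFlowFrameU L M β U μ m)) q * evalM (fsub (klFlowFrameU L M β U μ (m + 1)) (klFlowFrameU L M β U μ m)) q) / (β * (L : ℝ) ^ 2) : ℝ)) : ℂ) * (((uvWeightFn (klScale klE0 m) (matsubaraFreq β M i) (frameLevel μ (klFlowFrameU L M β U μ (m + 1)) q) : ℝ) : ℂ) * resolventFnXi (β * (L : ℝ) ^ 2) 0 (matsubaraFreq β M i) (frameLevel μ (klFlowFrameU L M β U μ (m + 1)) q + uvWeightFn (klScale klE0 m) (matsubaraFreq β M i) (frameLevel μ (klFlowFrameU L M β U μ (m + 1)) q) * evalM (fsub (klFlowFrameU L M β U μ (m + 1)) (klFlowFrameU L M β U μ m)) q)))) q'‖ ≤ (δ * δ / |(β * (L : ℝ) ^ 2)|) * (X * (|(β * (L : ℝ) ^ 2)|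 * (6 / klScale klE0 m))) * (Nat.factorial 0 : ℝ) *
        (2 * (2 * (2 ^ 10 * (4 : ℝ) ^ m) + 2 * (8 * (4 * (4 + (4 : ℝ) ^ m * (2 ^ 10 *
            (1 + (Real.pi ^ 8 * ((curveExtC X G.S 1 + curveExtC X Q.S' 1 * |U|) * U ^ 2) + ∑ j ∈ range 5, R.Gfr j * uPow j U)))) *
            (1 + 4 / klScale klE0 m * 1) + 2 ^ 10 * (4 : ℝ) ^ m) * (1 + 6 / klScale klE0 m * (1 + δ * X))))) ^ 0 := by
    intro i _ q'
    have h := norm_iteratedFDeriv_J₂_flowFrame_le (hR := hRG) (hGS := hGS) (hQS := hQS) (hμ := hμ) (h4N := h4N) (hX := hX) (hP := hP) (hT := hTJ)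
      (hmn := hmn) (hδ := hδ) (hδΛ := hδΛ) (hω := hω i) (c := (β * (L : ℝ) ^ 2)) (Nat.zero_le Md) q'
    rw [norm_iteratedFDeriv_zero] at h
    exact h
  have h5 : ∀ i ∈ ({omega0 M, (omega0 M).rev} : Finset (MatsubaraIdx M)), ∀ q' : Momentum, ‖iteratedFDeriv ℝ Md (fun q : Momentum => (((((evalM (fsub (klFlowFrameU L M β U μ (m + 1)) (klFlowFrameU L M β U μ m)) q / (β * (L : ℝ) ^ 2) : ℝ)) : ℂ) * (((uvWeightFn (klScale klE0 m) (matsubaraFreq β M i) (frameLevel μ (klFlowFrameU L M β U μ (m + 1)) q) : ℝ) : ℂ) * resolventFnXi (β * (L : ℝ) ^ 2) 0 (matsubaraFreq β M i) (frameLevel μ (klFlowFrameU L M β U μ (m + 1)) q + uvWeightFn (klScale klE0 m) (matsubaraFreq β M i) (frameLevel μ (klFlowFrameU L M β U μ (m + 1)) q) * evalM (fsub (klFlowFrameU L M β U μ (m + 1)) (klFlowFrameU L M β U μ m)) q))) * ((((evalM (fsub (klFlowFrameU L M β U μ (m + 1)) (klFlowFrameU L M β U μ m)) q / (β * (L : ℝ)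 ^ 2) : ℝ)) : ℂ) * (((uvWeightFn (klScale klE0 m) (matsubaraFreq β M i) (frameLevel μ (klFlowFrameU L M β U μ (m + 1)) q) : ℝ) : ℂ) * resolventFnXi (β * (L : ℝ) ^ 2) 0 (matsubaraFreq β M i) (frameLevel μ (klFlowFrameU L M β U μ (m + 1)) q + uvWeightFn (klScale klE0 m) (matsubaraFreq β M i) (frameLevel μ (klFlowFrameU L M β U μ (m + 1)) q) * evalM (fsub (klFlowFrameU L M β U μ (m + 1)) (klFlowFrameU L M β U μ m)) q))) - (2 : ℂ) * ((((evalM (fsub (klFlowFrameU L M β U μ (m + 1)) (klFlowFrameU L M β U μ m)) q / (β * (L : ℝ) ^ 2) : ℝ)) : ℂ) * (((uvWeightFn (klScale klE0 m) (matsubaraFreq β M i) (frameLevel μ (klFlowFrameU L M β U μ (m + 1)) q) : ℝ) : ℂ) * resolventFnXi (β * (L : ℝ) ^ 2) 0 (matsubaraFreq β M i) (frameLevel μ (klFlowFrameU L M β U μ (m + 1)) q + uvWeightFn (klScale klE0 m) (matsubaraFreq β M i) (frameLevel μ (klFlowFrameU L M β U μ (m + 1)) q) * evalM (fsub (klFlowFrameU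 L M β U μ (m + 1)) (klFlowFrameU L M β U μ m)) q))))) q'‖ ≤ (δ / |(β * (L : ℝ) ^ 2)| * (X * (|(β * (L : ℝ) ^ 2)| * (6 / klScale klE0 m)))) * (δ / |(β * (L : ℝ) ^ 2)| * (X * (|(β * (L : ℝ) ^ 2)| * (6 / klScale klE0 m)))) * (Nat.factorial Md : ℝ) *
          (2 * (2 * (2 * (2 ^ 10 * (4 : ℝ) ^ m) + 2 * (8 * (4 * (4 + (4 : ℝ) ^ m * (2 ^ 10 *
              (1 + (Real.pi ^ 8 * ((curveExtC X G.S 1 + curveExtC X Q.S' 1 * |U|) * U ^ 2) + ∑ j ∈ range 5, R.Gfr j * uPow j U)))) *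
              (1 + 4 / klScale klE0 m * 1) + 2 ^ 10 * (4 : ℝ) ^ m) * (1 + 6 / klScale klE0 m * (1 + δ * X)))))) ^ Md +
        2 * ((δ / |(β * (L : ℝ) ^ 2)|) * (X * (|(β * (L : ℝ) ^ 2)| * (6 / klScale klE0 m))) * (Nat.factorial Md : ℝ) *
          (2 * (2 * (2 ^ 10 * (4 : ℝ) ^ m) + 2 * (8 * (4 * (4 + (4 : ℝ) ^ m * (2 ^ 10 *
              (1 + (Real.pi ^ 8 * ((curveExtC X G.S 1 + curveExtC X Q.S' 1 * |U|) * U ^ 2) + ∑ j ∈ range 5, R.Gfr j * uPow j U)))) *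
              (1 + 4 / klScale klE0 m * 1) + 2 ^ 10 * (4 : ℝ) ^ m) * (1 + 6 / klScale klE0 m * (1 + δ * X))))) ^ Md) :=
    fun i _ q' => norm_iteratedFDeriv_J₁_flowFrame_le (hR := hRG) (hGS := hGS) (hQS := hQS) (hμ := hμ) (h4N := h4N) (hX := hX) (hP := hP) (hT := hTJ)
      (hmn := hmn) (hδ := hδ) (hδΛ := hδΛ) (hω := hω i) (c := (β * (L : ℝ) ^ 2)) le_rfl q'
  have h6 : ∀ i ∈ ({omega0 M, (omega0 M).rev} : Finset (MatsubaraIdx M)), ∀ q' : Momentum, ‖(fun q : Momentum => (((((evalM (fsub (klFlowFrameU L M β U μ (m + 1)) (klFlowFrameU L M β U μ m)) q / (β * (L : ℝ) ^ 2) : ℝ)) : ℂ) * (((uvWeightFn (klScale klE0 m) (matsubaraFreq β M i) (frameLevel μ (klFlowFrameU L M β U μ (m + 1)) q) : ℝ) : ℂ) * resolventFnXi (β * (L : ℝ) ^ 2) 0 (matsubaraFreq β M i) (frameLevel μ (klFlowFrameU L M β U μ (m + 1)) q + uvWeightFn (klScale klE0 m) (matsubaraFreq β M i) (frameLevel μ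 (klFlowFrameU L M β U μ (m + 1)) q) * evalM (fsub (klFlowFrameU L M β U μ (m + 1)) (klFlowFrameU L M β U μ m)) q))) * ((((evalM (fsub (klFlowFrameU L M β U μ (m + 1)) (klFlowFrameU L M β U μ m)) q / (β * (L : ℝ) ^ 2) : ℝ)) : ℂ) * (((uvWeightFn (klScale klE0 m) (matsubaraFreq β M i) (frameLevel μ (klFlowFrameU L M β U μ (m + 1)) q) : ℝ) : ℂ) * resolventFnXi (β * (L : ℝ) ^ 2) 0 (matsubaraFreq β M i) (frameLevel μ (klFlowFrameU L M β U μ (m + 1)) q + uvWeightFn (klScale klE0 m) (matsubaraFreq β M i) (frameLevel μ (klFlowFrameU L M β U μ (m + 1)) q) * evalM (fsub (klFlowFrameU L M β U μ (m + 1)) (klFlowFrameU L M β U μ m)) q))) - (2 : ℂ) * ((((evalM (fsub (klFlowFrameU L M β U μ (m + 1)) (klFlowFrameU L M β U μ m)) q / (β * (L : ℝ) ^ 2) : ℝ)) : ℂ) * (((uvWeightFn (klScale klE0 m) (matsubaraFreq β M i) (frameLevel μ (klFlowFrameU L M β U μ (m + 1)) q) : ℝ) : ℂ) * resolventFnXi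 (β * (L : ℝ) ^ 2) 0 (matsubaraFreq β M i) (frameLevel μ (klFlowFrameU L M β U μ (m + 1)) q + uvWeightFn (klScale klE0 m) (matsubaraFreq β M i) (frameLevel μ (klFlowFrameU L M β U μ (m + 1)) q) * evalM (fsub (klFlowFrameU L M β U μ (m + 1)) (klFlowFrameU L M β U μ m)) q))))) q'‖ ≤ (δ / |(β * (L : ℝ) ^ 2)| * (X * (|(β * (L : ℝ) ^ 2)| * (6 / klScale klE0 m)))) * (δ / |(β * (L : ℝ) ^ 2)| * (X * (|(β * (L : ℝ) ^ 2)| * (6 / klScale klE0 m)))) * (Nat.factorial 0 : ℝ) *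
          (2 * (2 * (2 * (2 ^ 10 * (4 : ℝ) ^ m) + 2 * (8 * (4 * (4 + (4 : ℝ) ^ m * (2 ^ 10 *
              (1 + (Real.pi ^ 8 * ((curveExtC X G.S 1 + curveExtC X Q.S' 1 * |U|) * U ^ 2) + ∑ j ∈ range 5, R.Gfr j * uPow j U)))) *
              (1 + 4 / klScale klE0 m * 1) + 2 ^ 10 * (4 : ℝ) ^ m) * (1 + 6 / klScale klE0 m * (1 + δ * X)))))) ^ 0 +
        2 * ((δ / |(β * (L : ℝ) ^ 2)|) * (X * (|(β * (L : ℝ) ^ 2)| * (6 / klScale klE0 m))) * (Nat.factorial 0 : ℝ) *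
          (2 * (2 * (2 ^ 10 * (4 : ℝ) ^ m) + 2 * (8 * (4 * (4 + (4 : ℝ) ^ m * (2 ^ 10 *
              (1 + (Real.pi ^ 8 * ((curveExtC X G.S 1 + curveExtC X Q.S' 1 * |U|) * U ^ 2) + ∑ j ∈ range 5, R.Gfr j * uPow j U)))) *
              (1 + 4 / klScale klE0 m * 1) + 2 ^ 10 * (4 : ℝ) ^ m) * (1 + 6 / klScale klE0 m * (1 + δ * X))))) ^ 0) := by
    intro i _ q'
    have h := norm_iteratedFDeriv_J₁_flowFrame_le (hR := hRG) (hGS := hGS) (hQS := hQS) (hμ := hμ) (h4N := h4N) (hX := hX) (hP := hP) (hT := hTJ)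
      (hmn := hmn) (hδ := hδ) (hδΛ := hδΛ) (hω := hω i) (c := (β * (L : ℝ) ^ 2)) (Nat.zero_le Md) q'
    rw [norm_iteratedFDeriv_zero] at h
    exact h
  have h := norm_iteratedFDeriv_klLocSelfEnergyRe_flowFrame_sub_le_aliasing hβ U μ m hOK₁ hOK₂ hB0 hB hfdist hfd hZ₂ hZ j q hN0 hN hq₂ hq₁ hM hRmom hSE
    h1 h2 h3 h4 h5 h6
  rw [add_self_div_two] at h
  exact h

end Flow

end Summit.HubbardSuperconductivity.HubbardSuperconductivity.Theorems.EngineV8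

end
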